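import Literature.MathematicalPhysics.QuantumFieldTheory.ConformalBootstrap3D.HRCoeffIntervalBounds
import Literature.MathematicalPhysics.QuantumFieldTheory.ConformalBootstrap3D.HRCoeffCellBounds

/-!
# Hogervorst–Rychkov coefficients on cells touching the unitarity bound: the pole-normalised array

For a spinning primary (`ℓ ≥ 1`) the blocks `g^{Δ₁₂,Δ₃₄}_{Δ,ℓ}` with `Δ₁₂Δ₃₄ ≠ 0` (the `σ–ε` system's
`gpm`, `gmm`) have a simple pole at the unitarity bound `Δ = ℓ + 1`; through the Dolan–Osborn
factorisation `A_{n,j}(a,b) = Π_{ab}/Π_{00} · A_{n,j}(0,0)` (`hrCoeffAB_eq_doPochFactor_div_mul`) the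
pole sits in the factor `((x+c)/x)²`, `x = (Δ-ℓ-1)/2`, carried by every coefficient BELOW the leading
twist line (`j + 2 ≤ ℓ + n`), where the equal-dimension array `A_{n,j}(0,0)` itself vanishes to first
order. This file types the POLE-NORMALISED equal-dimension array
`Ã_{n,j}(Δ) = A_{n,j}(Δ)/(Δ-ℓ-1)` below the leading line, `= A_{n,j}(Δ)` on it (`hrCoeffBd`), its
recursion — Hogervorst–Rychkov's with the spin-lowering weight off the leading line replaced by
`γ̃⁻ = (Δ-ℓ-1) j'/(2j'+1)` (`hrCoeffBd_succ`) and level one in closed form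
(`Ã_{1,ℓ+1} = (Δ+ℓ)(ℓ+1)/(2(2ℓ+1))`, `Ã_{1,ℓ-1} = ℓ/(2(2ℓ+1))`) — and INTERVAL TABLES
`hrCoeffBdLo/Hi a b ℓ n j` valid on cells `[a, b]` with `a ≥ ℓ + 1` (the bound itself allowed: all
pivots from level two on are positive there, `casimirPivot3D_pos_of_two_le`):
`0 ≤ Lo ≤ Ã_{n,j}(Δ) ≤ Hi` for `Δ ∈ [a,b]`, `Δ > ℓ+1` (`hrCoeffBd_mem_Icc`). With the ratio enclosures
of `HRCoeffABBoundTables` this gives finite tables for `(Δ-ℓ-1)·A_{n,j}(c,c;Δ,ℓ)` down to the bound —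
the odd-sector light-block cells of the `σ–ε` system that START at `ℓ + 1`.
[cite: HogervorstRychkov2013, §3 eqs. (3.8)–(3.10)]
-/

noncomputable section

namespace Literature.MathematicalPhysics.QuantumFieldTheory.ConformalBootstrap3D

open Finset Set

/-! ### The pole-normalised array and its recursion -/

/-- `Ã_{n,j}(Δ)`: `A_{n,j}(Δ)/(Δ-ℓ-1)` below the leading twist line (`j + 2 ≤ ℓ + n`), `A_{n,j}(Δ)`
on it. [cite: HogervorstRychkov2013, §3 eq. (3.9)] -/
def hrCoeffBd (Δ : ℝ) (ℓ n j : ℕ) : ℝ :=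
  if j + 2 ≤ ℓ + n then hrCoeff Δ ℓ n j / (Δ - ℓ - 1) else hrCoeff Δ ℓ n j

/-- [folklore] -/
theorem hrCoeffBd_of_le {Δ : ℝ} {ℓ n j : ℕ} (h : j + 2 ≤ ℓ + n) :
    hrCoeffBd Δ ℓ n j = hrCoeff Δ ℓ n j / (Δ - ℓ - 1) := by
  unfold hrCoeffBd; rw [if_pos h]

/-- [folklore] -/
theorem hrCoeffBd_of_not_le {Δ : ℝ} {ℓ n j : ℕ} (h : ¬ j + 2 ≤ ℓ + n) :
    hrCoeffBd Δ ℓ n j = hrCoeff Δ ℓ n j := by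
  unfold hrCoeffBd; rw [if_neg h]

/-- Recovering `A` from `Ã`: `A = Ã · (Δ-ℓ-1)` below the leading line. [folklore] -/
theorem hrCoeff_eq_hrCoeffBd_mul {Δ : ℝ} {ℓ n j : ℕ} (hx : Δ - ℓ - 1 ≠ 0) (h : j + 2 ≤ ℓ + n) :
    hrCoeff Δ ℓ n j = hrCoeffBd Δ ℓ n j * (Δ - ℓ - 1) := by
  rw [hrCoeffBd_of_le h, div_mul_cancel₀ _ hx]

/-- Off the descendant range `Ã = 0`. [folklore] -/
theorem hrCoeffBd_eq_zero_of_not_inDescendantRange (Δ : ℝ) {ℓ n j : ℕ}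
    (h : ¬ InDescendantRange ℓ n j) : hrCoeffBd Δ ℓ n j = 0 := by
  unfold hrCoeffBd
  rw [hrCoeff_eq_zero_of_not_inDescendantRange Δ h]
  simp

/-- The modified spin-lowering weight `γ̃⁻_{Δ,j'} = (Δ-ℓ-1) j'/(2j'+1)` (the leading-line weight
`γ⁻_{Δ+n,ℓ+n} = (Δ-ℓ-1)² (ℓ+n)/(2(ℓ+n)+1)` with one factor `Δ-ℓ-1` moved into the normalisation).
[cite: HogervorstRychkov2013, §3 eq. (3.8)] -/
def hrGammaMinusBd (Δ : ℝ) (ℓ j : ℕ) : ℝ :=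
  (Δ - ℓ - 1) * (j : ℝ) / (2 * (j : ℝ) + 1)

/-- [folklore] -/
theorem hrGammaMinusBd_nonneg {Δ : ℝ} {ℓ : ℕ} (hΔ : (ℓ : ℝ) + 1 ≤ Δ) (j : ℕ) :
    0 ≤ hrGammaMinusBd Δ ℓ j := by
  unfold hrGammaMinusBd
  apply div_nonneg (mul_nonneg (by linarith) (Nat.cast_nonneg j)) (by positivity)

/-- [folklore] -/
theorem hrGammaMinusBd_mono {Δ Δ' : ℝ} (ℓ : ℕ) (h : Δ ≤ Δ') (j : ℕ) :
    hrGammaMinusBd Δ ℓ j ≤ hrGammaMinusBd Δ' ℓ j := by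
  unfold hrGammaMinusBd
  apply div_le_div_of_nonneg_right _ (by positivity)
  exact mul_le_mul_of_nonneg_right (by linarith) (Nat.cast_nonneg j)

/-- **The recursion of `Ã`.** On the descendant range, for `Δ ≠ ℓ + 1`:
`Ã_{m+1,j} = ([j≠0] γ⁺_{Δ+m,j-1} Ã_{m,j-1} + W Ã_{m,j+1}) / P_{m+1,j}(Δ)` with `W = γ̃⁻_{Δ,j+1}` when the
spin-lowering parent lies on the leading line (`j + 1 = ℓ + m`) and `W = γ⁻_{Δ+m,j+1}` otherwise.
[cite: HogervorstRychkov2013, §3 eq. (3.9)] -/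
theorem hrCoeffBd_succ {Δ : ℝ} {ℓ m j : ℕ} (hx : Δ - ℓ - 1 ≠ 0) (hr : InDescendantRange ℓ (m + 1) j) :
    hrCoeffBd Δ ℓ (m + 1) j =
      ((if j = 0 then 0 else hrGammaPlus (Δ + m) (j - 1) * hrCoeffBd Δ ℓ m (j - 1)) +
          (if j + 1 = ℓ + m then hrGammaMinusBd Δ ℓ (j + 1) else hrGammaMinus (Δ + m) (j + 1)) *
            hrCoeffBd Δ ℓ m (j + 1)) /
        casimirPivot3D Δ ℓ (m + 1) j := by
  obtain ⟨hr1, hr2, hr3⟩ := hr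
  by_cases hlead : j = ℓ + m + 1
  · -- on the leading line: nothing is normalised, the spin-lowering parent is off range
    have h2 : hrCoeffBd Δ ℓ m (j + 1) = 0 :=
      hrCoeffBd_eq_zero_of_not_inDescendantRange Δ (by unfold InDescendantRange; omega)
    have h2' : hrCoeff Δ ℓ m (j + 1) = 0 :=
      hrCoeff_eq_zero_of_not_inDescendantRange Δ (by unfold InDescendantRange; omega)
    rw [hrCoeffBd_of_not_le (show ¬ (j + 2 ≤ ℓ + (m + 1)) by omega), hrCoeff_succ, h2', h2,
      hrCoeffBd_of_not_le (show ¬ (j - 1 + 2 ≤ ℓ + m) by omega),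
      if_neg (show ¬ (j + 1 = ℓ + m) by omega)]
  · by_cases hmd : j + 1 = ℓ + m
    · -- the spin-lowering parent lies on the leading line
      have hj' : (j : ℝ) + 1 = (ℓ : ℝ) + m := by exact_mod_cast hmd
      have e : Δ + (m : ℝ) - ((j : ℝ) + 1) - 1 = Δ - ℓ - 1 := by linarith
      rw [hrCoeffBd_of_le (show j + 2 ≤ ℓ + (m + 1) by omega), hrCoeff_succ, if_pos hmd,
        ← hrCoeffBd_of_not_le (show ¬ (j + 1 + 2 ≤ ℓ + m) by omega)]
      rcases Nat.eq_zero_or_pos j with hz | hz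
      · rw [if_pos hz, if_pos hz]
        unfold hrGammaMinus hrGammaMinusBd
        push_cast
        rw [e]
        field_simp
        ring
      · rw [if_neg (show j ≠ 0 by omega), if_neg (show j ≠ 0 by omega),
          hrCoeff_eq_hrCoeffBd_mul hx (show j - 1 + 2 ≤ ℓ + m by omega)]
        unfold hrGammaMinus hrGammaMinusBd
        push_cast
        rw [e]
        field_simp
    · -- deep: both parents normalised
      rw [hrCoeffBd_of_le (show j + 2 ≤ ℓ + (m + 1) by omega), hrCoeff_succ, if_neg hmd,
        hrCoeff_eq_hrCoeffBd_mul hx (show j + 1 + 2 ≤ ℓ + m by omega)]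
      rcases Nat.eq_zero_or_pos j with hz | hz
      · rw [if_pos hz, if_pos hz]
        field_simp
        ring
      · rw [if_neg (show j ≠ 0 by omega), if_neg (show j ≠ 0 by omega),
          hrCoeff_eq_hrCoeffBd_mul hx (show j - 1 + 2 ≤ ℓ + m by omega)]
        field_simp

/-! ### Level one in closed form -/

/-- `Ã_{1,ℓ+1} = (Δ+ℓ)(ℓ+1)/(2(2ℓ+1))` on `Δ ≥ ℓ + 1`. [cite: HogervorstRychkov2013, §3 eq. (3.10)] -/
theorem hrCoeffBd_one_succ {Δ : ℝ} {ℓ : ℕ} (hΔ : (ℓ : ℝ) + 1 ≤ Δ) :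
    hrCoeffBd Δ ℓ 1 (ℓ + 1) = (Δ + ℓ) * ((ℓ : ℝ) + 1) / (2 * (2 * (ℓ : ℝ) + 1)) := by
  rw [hrCoeffBd_of_not_le (by omega), hrCoeff_one_succ_of_le hΔ]

/-- `Ã_{1,ℓ-1} = ℓ/(2(2ℓ+1))` for `ℓ ≥ 1` (`j + 1 = ℓ`), `Δ ≠ ℓ + 1`, `Δ ≥ ℓ + 1`.
[cite: HogervorstRychkov2013, §3 eq. (3.10)] -/
theorem hrCoeffBd_one_pred {Δ : ℝ} {ℓ j : ℕ} (hΔ : (ℓ : ℝ) + 1 ≤ Δ) (hx : Δ - ℓ - 1 ≠ 0)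
    (hj : j + 1 = ℓ) : hrCoeffBd Δ ℓ 1 j = (ℓ : ℝ) / (2 * (2 * (ℓ : ℝ) + 1)) := by
  obtain ⟨k, hk⟩ : ∃ k, ℓ = k + 1 := ⟨ℓ - 1, by omega⟩
  have hjk : j = k := by omega
  rw [hrCoeffBd_of_le (by omega), hk, hjk, hrCoeff_one_pred (by rw [← hk]; exact hΔ)]
  have hx' : Δ - ((k : ℝ) + 1) - 1 ≠ 0 := by
    have : ((k + 1 : ℕ) : ℝ) = (k : ℝ) + 1 := by push_cast; ring
    rw [hk, this] at hx; exact hx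
  push_cast
  field_simp

/-- At level one only `j = ℓ ± 1` are on the range. [folklore] -/
theorem hrCoeffBd_one_eq_zero {Δ : ℝ} {ℓ j : ℕ} (h1 : j ≠ ℓ + 1) (h2 : j + 1 ≠ ℓ) :
    hrCoeffBd Δ ℓ 1 j = 0 :=
  hrCoeffBd_eq_zero_of_not_inDescendantRange Δ (by unfold InDescendantRange; omega)

/-! ### The tables -/

/-- **Lower table** for `Ã_{n,j}(Δ)`, `Δ ∈ [a, b]`, `a ≥ ℓ + 1`: levels `0, 1` in closed form, then the
`Ã`-recursion with lower weight enclosures (`γ̃⁻` at `a`) and the pivot at `b`; `0` off range.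
[cite: HogervorstRychkov2013, §3 eq. (3.9)] -/
def hrCoeffBdLo (a b : ℝ) (ℓ : ℕ) : ℕ → ℕ → ℝ
  | 0, j => if j = ℓ then 1 else 0
  | 1, j => if j = ℓ + 1 then (a + ℓ) * ((ℓ : ℝ) + 1) / (2 * (2 * (ℓ : ℝ) + 1))
      else if j + 1 = ℓ then (ℓ : ℝ) / (2 * (2 * (ℓ : ℝ) + 1)) else 0
  | m + 2, j =>
      if InDescendantRange ℓ (m + 2) j then
        ((if j = 0 then 0 else
            hrGammaPlusLo (a + (m + 1 : ℕ)) (b + (m + 1 : ℕ)) (j - 1) * hrCoeffBdLo a b ℓ (m + 1) (j - 1)) +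
          (if j + 1 = ℓ + (m + 1) then hrGammaMinusBd a ℓ (j + 1)
            else hrGammaMinusLo (a + (m + 1 : ℕ)) (b + (m + 1 : ℕ)) (j + 1)) *
            hrCoeffBdLo a b ℓ (m + 1) (j + 1)) /
          casimirPivot3D b ℓ (m + 2) j
      else 0

/-- **Upper table** for `Ã_{n,j}(Δ)`, `Δ ∈ [a, b]`, `a ≥ ℓ + 1`: upper weight enclosures (`γ̃⁻` at
`b`), pivot at `a`. [cite: HogervorstRychkov2013, §3 eq. (3.9)] -/
def hrCoeffBdHi (a b : ℝ) (ℓ : ℕ) : ℕ → ℕ → ℝ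
  | 0, j => if j = ℓ then 1 else 0
  | 1, j => if j = ℓ + 1 then (b + ℓ) * ((ℓ : ℝ) + 1) / (2 * (2 * (ℓ : ℝ) + 1))
      else if j + 1 = ℓ then (ℓ : ℝ) / (2 * (2 * (ℓ : ℝ) + 1)) else 0
  | m + 2, j =>
      if InDescendantRange ℓ (m + 2) j then
        ((if j = 0 then 0 else
            hrGammaPlusHi (a + (m + 1 : ℕ)) (b + (m + 1 : ℕ)) (j - 1) * hrCoeffBdHi a b ℓ (m + 1) (j - 1)) +
          (if j + 1 = ℓ + (m + 1) then hrGammaMinusBd b ℓ (j + 1)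
            else hrGammaMinusHi (a + (m + 1 : ℕ)) (b + (m + 1 : ℕ)) (j + 1)) *
            hrCoeffBdHi a b ℓ (m + 1) (j + 1)) /
          casimirPivot3D a ℓ (m + 2) j
      else 0

/-- [folklore] -/
theorem hrCoeffBdLo_two (a b : ℝ) (ℓ m j : ℕ) :
    hrCoeffBdLo a b ℓ (m + 2) j =
      if InDescendantRange ℓ (m + 2) j then
        ((if j = 0 then 0 else
            hrGammaPlusLo (a + (m + 1 : ℕ)) (b + (m + 1 : ℕ)) (j - 1) * hrCoeffBdLo a b ℓ (m + 1) (j - 1)) +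
          (if j + 1 = ℓ + (m + 1) then hrGammaMinusBd a ℓ (j + 1)
            else hrGammaMinusLo (a + (m + 1 : ℕ)) (b + (m + 1 : ℕ)) (j + 1)) *
            hrCoeffBdLo a b ℓ (m + 1) (j + 1)) /
          casimirPivot3D b ℓ (m + 2) j
      else 0 := rfl

/-- [folklore] -/
theorem hrCoeffBdHi_two (a b : ℝ) (ℓ m j : ℕ) :
    hrCoeffBdHi a b ℓ (m + 2) j =
      if InDescendantRange ℓ (m + 2) j then
        ((if j = 0 then 0 else
            hrGammaPlusHi (a + (m + 1 : ℕ)) (b + (m + 1 : ℕ)) (j - 1) * hrCoeffBdHi a b ℓ (m + 1) (j - 1)) +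
          (if j + 1 = ℓ + (m + 1) then hrGammaMinusBd b ℓ (j + 1)
            else hrGammaMinusHi (a + (m + 1 : ℕ)) (b + (m + 1 : ℕ)) (j + 1)) *
            hrCoeffBdHi a b ℓ (m + 1) (j + 1)) /
          casimirPivot3D a ℓ (m + 2) j
      else 0 := rfl

/-! ### The enclosure -/

/-- **Interval bounds for the pole-normalised array down to the unitarity bound.** For `ℓ ≥ 1`,
`ℓ + 1 ≤ a ≤ Δ ≤ b` and `Δ > ℓ + 1`: `0 ≤ hrCoeffBdLo a b ℓ n j ≤ Ã_{n,j}(Δ) ≤ hrCoeffBdHi a b ℓ n j`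
for all `n, j`. Levels `0, 1` by the closed forms; from level two on by the `Ã`-recursion with
sandwiched parents, weight enclosures (`sqLower/sqUpper` for `γ^±`, monotonicity for `γ̃⁻`) and the
pivot `0 < P(a) ≤ P(Δ) ≤ P(b)` (`casimirPivot3D_pos_of_two_le`, valid AT the bound).
[cite: HogervorstRychkov2013, §3 eqs. (3.8)–(3.10)] -/
theorem hrCoeffBd_mem_Icc {a Δ b : ℝ} {ℓ : ℕ} (hℓ : 1 ≤ ℓ) (ha : (ℓ : ℝ) + 1 ≤ a) (h1 : a ≤ Δ)
    (h2 : Δ ≤ b) (hx : (ℓ : ℝ) + 1 < Δ) :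
    ∀ n j : ℕ, 0 ≤ hrCoeffBdLo a b ℓ n j ∧ hrCoeffBdLo a b ℓ n j ≤ hrCoeffBd Δ ℓ n j ∧
      hrCoeffBd Δ ℓ n j ≤ hrCoeffBdHi a b ℓ n j := by
  have hΔ : (ℓ : ℝ) + 1 ≤ Δ := ha.trans h1
  have hx0 : Δ - ℓ - 1 ≠ 0 := by intro h; linarith
  have hℓ0 : (0 : ℝ) ≤ ℓ := Nat.cast_nonneg ℓ
  -- level 0
  have P0 : ∀ j, 0 ≤ hrCoeffBdLo a b ℓ 0 j ∧ hrCoeffBdLo a b ℓ 0 j ≤ hrCoeffBd Δ ℓ 0 j ∧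
      hrCoeffBd Δ ℓ 0 j ≤ hrCoeffBdHi a b ℓ 0 j := by
    intro j
    show 0 ≤ (if j = ℓ then (1 : ℝ) else 0) ∧ (if j = ℓ then (1 : ℝ) else 0) ≤ hrCoeffBd Δ ℓ 0 j ∧
      hrCoeffBd Δ ℓ 0 j ≤ (if j = ℓ then (1 : ℝ) else 0)
    by_cases h : j = ℓ
    · subst h
      rw [if_pos rfl, hrCoeffBd_of_not_le (by omega), hrCoeff_zero_self]
      exact ⟨zero_le_one, le_rfl, le_rfl⟩
    · rw [if_neg h, hrCoeffBd_eq_zero_of_not_inDescendantRange Δ (by unfold InDescendantRange; omega)]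
      exact ⟨le_rfl, le_rfl, le_rfl⟩
  -- level 1
  have P1 : ∀ j, 0 ≤ hrCoeffBdLo a b ℓ 1 j ∧ hrCoeffBdLo a b ℓ 1 j ≤ hrCoeffBd Δ ℓ 1 j ∧
      hrCoeffBd Δ ℓ 1 j ≤ hrCoeffBdHi a b ℓ 1 j := by
    intro j
    show 0 ≤ (if j = ℓ + 1 then (a + ℓ) * ((ℓ : ℝ) + 1) / (2 * (2 * (ℓ : ℝ) + 1))
        else if j + 1 = ℓ then (ℓ : ℝ) / (2 * (2 * (ℓ : ℝ) + 1)) else 0) ∧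
      (if j = ℓ + 1 then (a + ℓ) * ((ℓ : ℝ) + 1) / (2 * (2 * (ℓ : ℝ) + 1))
        else if j + 1 = ℓ then (ℓ : ℝ) / (2 * (2 * (ℓ : ℝ) + 1)) else 0) ≤ hrCoeffBd Δ ℓ 1 j ∧
      hrCoeffBd Δ ℓ 1 j ≤ (if j = ℓ + 1 then (b + ℓ) * ((ℓ : ℝ) + 1) / (2 * (2 * (ℓ : ℝ) + 1))
        else if j + 1 = ℓ then (ℓ : ℝ) / (2 * (2 * (ℓ : ℝ) + 1)) else 0)
    by_cases hs : j = ℓ + 1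
    · rw [if_pos hs, if_pos hs, hs, hrCoeffBd_one_succ hΔ]
      have hal : 0 ≤ a + ℓ := by linarith
      refine ⟨div_nonneg (mul_nonneg hal (by positivity)) (by positivity), ?_, ?_⟩
      · exact div_le_div_of_nonneg_right (mul_le_mul_of_nonneg_right (by linarith) (by positivity))
          (by positivity)
      · exact div_le_div_of_nonneg_right (mul_le_mul_of_nonneg_right (by linarith) (by positivity))
          (by positivity)
    · by_cases hp : j + 1 = ℓ
      · rw [if_neg hs, if_pos hp, if_neg hs, hrCoeffBd_one_pred hΔ hx0 hp]
        exact ⟨by positivity, le_rfl, le_rfl⟩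
      · rw [if_neg hs, if_neg hp, if_neg hs, hrCoeffBd_one_eq_zero hs hp]
        exact ⟨le_rfl, le_rfl, le_rfl⟩
  -- the step from level m+1 ≥ 1 to level m+2
  have step : ∀ m, (∀ j, 0 ≤ hrCoeffBdLo a b ℓ (m + 1) j ∧
      hrCoeffBdLo a b ℓ (m + 1) j ≤ hrCoeffBd Δ ℓ (m + 1) j ∧
      hrCoeffBd Δ ℓ (m + 1) j ≤ hrCoeffBdHi a b ℓ (m + 1) j) →
      ∀ j, 0 ≤ hrCoeffBdLo a b ℓ (m + 2) j ∧
        hrCoeffBdLo a b ℓ (m + 2) j ≤ hrCoeffBd Δ ℓ (m + 2) j ∧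
        hrCoeffBd Δ ℓ (m + 2) j ≤ hrCoeffBdHi a b ℓ (m + 2) j := by
    intro m ih j
    rw [hrCoeffBdLo_two, hrCoeffBdHi_two]
    by_cases hr : InDescendantRange ℓ (m + 2) j
    · rw [if_pos hr, if_pos hr, hrCoeffBd_succ hx0 hr]
      have hpiv : 0 < casimirPivot3D a ℓ (m + 2) j :=
        casimirPivot3D_pos_of_two_le ha (by omega) hr.1
      have hp1 := casimirPivot3D_mono h1 ℓ (m + 2) j
      have hp2 := casimirPivot3D_mono h2 ℓ (m + 2) j
      have hE1 : a + ((m + 1 : ℕ) : ℝ) ≤ Δ + ((m + 1 : ℕ) : ℝ) := by linarith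
      have hE2 : Δ + ((m + 1 : ℕ) : ℝ) ≤ b + ((m + 1 : ℕ) : ℝ) := by linarith
      -- the `γ⁺` parent term
      have hP : 0 ≤ (if j = 0 then (0 : ℝ) else
            hrGammaPlusLo (a + (m + 1 : ℕ)) (b + (m + 1 : ℕ)) (j - 1) * hrCoeffBdLo a b ℓ (m + 1) (j - 1)) ∧
          (if j = 0 then (0 : ℝ) else
            hrGammaPlusLo (a + (m + 1 : ℕ)) (b + (m + 1 : ℕ)) (j - 1) * hrCoeffBdLo a b ℓ (m + 1) (j - 1)) ≤
          (if j = 0 then (0 : ℝ) else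
            hrGammaPlus (Δ + ((m + 1 : ℕ) : ℝ)) (j - 1) * hrCoeffBd Δ ℓ (m + 1) (j - 1)) ∧
          (if j = 0 then (0 : ℝ) else
            hrGammaPlus (Δ + ((m + 1 : ℕ) : ℝ)) (j - 1) * hrCoeffBd Δ ℓ (m + 1) (j - 1)) ≤
          (if j = 0 then (0 : ℝ) else
            hrGammaPlusHi (a + (m + 1 : ℕ)) (b + (m + 1 : ℕ)) (j - 1) * hrCoeffBdHi a b ℓ (m + 1) (j - 1)) := by
        by_cases hj0 : j = 0
        · simp only [hj0, if_true]; exact ⟨le_rfl, le_rfl, le_rfl⟩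
        · simp only [if_neg hj0]
          obtain ⟨hl0, hl, hh⟩ := ih (j - 1)
          exact mul_sandwich (hrGammaPlusLo_nonneg _ _ _) (hrGammaPlusLo_le hE1 hE2 _)
            (hrGammaPlus_le_hi hE1 hE2 _) hl0 hl hh
      -- the spin-lowering parent term
      have hW : 0 ≤ (if j + 1 = ℓ + (m + 1) then hrGammaMinusBd a ℓ (j + 1)
            else hrGammaMinusLo (a + (m + 1 : ℕ)) (b + (m + 1 : ℕ)) (j + 1)) ∧
          (if j + 1 = ℓ + (m + 1) then hrGammaMinusBd a ℓ (j + 1)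
            else hrGammaMinusLo (a + (m + 1 : ℕ)) (b + (m + 1 : ℕ)) (j + 1)) ≤
          (if j + 1 = ℓ + (m + 1) then hrGammaMinusBd Δ ℓ (j + 1)
            else hrGammaMinus (Δ + ((m + 1 : ℕ) : ℝ)) (j + 1)) ∧
          (if j + 1 = ℓ + (m + 1) then hrGammaMinusBd Δ ℓ (j + 1)
            else hrGammaMinus (Δ + ((m + 1 : ℕ) : ℝ)) (j + 1)) ≤
          (if j + 1 = ℓ + (m + 1) then hrGammaMinusBd b ℓ (j + 1)
            else hrGammaMinusHi (a + (m + 1 : ℕ)) (b + (m + 1 : ℕ)) (j + 1)) := by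
        by_cases hmd : j + 1 = ℓ + (m + 1)
        · simp only [if_pos hmd]
          exact ⟨hrGammaMinusBd_nonneg ha _, hrGammaMinusBd_mono ℓ h1 _, hrGammaMinusBd_mono ℓ h2 _⟩
        · simp only [if_neg hmd]
          exact ⟨hrGammaMinusLo_nonneg _ _ _, hrGammaMinusLo_le hE1 hE2 _, hrGammaMinus_le_hi hE1 hE2 _⟩
      obtain ⟨hm0, hm, hmh⟩ := ih (j + 1)
      obtain ⟨hW0, hWl, hWh⟩ := hW
      have hM := mul_sandwich hW0 hWl hWh hm0 hm hmh
      obtain ⟨hP0, hPl, hPh⟩ := hP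
      obtain ⟨hM0, hMl, hMh⟩ := hM
      have key := div_sandwich (add_nonneg hP0 hM0) (add_le_add hPl hMl) (add_le_add hPh hMh) hpiv hp1
        hp2
      push_cast at key ⊢
      exact key
    · rw [if_neg hr, if_neg hr, hrCoeffBd_eq_zero_of_not_inDescendantRange Δ hr]
      exact ⟨le_rfl, le_rfl, le_rfl⟩
  -- assemble
  have main : ∀ n, ∀ j, 0 ≤ hrCoeffBdLo a b ℓ (n + 1) j ∧
      hrCoeffBdLo a b ℓ (n + 1) j ≤ hrCoeffBd Δ ℓ (n + 1) j ∧
      hrCoeffBd Δ ℓ (n + 1) j ≤ hrCoeffBdHi a b ℓ (n + 1) j := by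
    intro n
    induction n with
    | zero => exact P1
    | succ m ih => exact step m ih
  intro n
  cases n with
  | zero => exact P0
  | succ n => exact main n

/-- The lower table is non-negative (`a < b` or any `Δ ∈ (ℓ+1, b]` available; stated for `a < b`).
[cite: HogervorstRychkov2013, §3 eq. (3.9)] -/
theorem hrCoeffBdLo_nonneg {a b : ℝ} {ℓ : ℕ} (hℓ : 1 ≤ ℓ) (ha : (ℓ : ℝ) + 1 ≤ a) (hab : a < b)
    (n j : ℕ) : 0 ≤ hrCoeffBdLo a b ℓ n j :=
  (hrCoeffBd_mem_Icc hℓ ha hab.le le_rfl (lt_of_le_of_lt ha hab) n j).1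

end Literature.MathematicalPhysics.QuantumFieldTheory.ConformalBootstrap3D
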